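import Summits.FinalStateConjecture.FinalStateConjecture.Theorems.StarvedNecksNecksCertifyStubSeamSurgeryGlue
import Summits.FinalStateConjecture.FinalStateConjecture.Theorems.StarvedNecksNecksCertifyStubSeamSurgeryDisc
import Summits.FinalStateConjecture.FinalStateConjecture.Theorems.StarvedNecksNecksCertifyStubSeamSurgeryClosure

/-!
# Route StarvedNecks — crux `NecksCertify`, line `two-cap-focusing-ledger`: seam surgery, per-hole clauses of `d₂`

Helper file for the registered stub `stub_seamSurgery` (N2): the clauses of the seamed decomposition
that concern ONE hole, stated directly for the components of the new decomposition — an abstract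
re-clocked background `B₂` (same domain and radius as the hole's boosted Kerr background, time
shifted by `−s`), the new chart `Gl ∘ inclusion`, and the shrunk flat domain `U₂` — so that the final
assembly only applies them:

* `isLateChart₂` — structure field `isLateChart`;
* `honestCore₂_two`, `honestCore₂_three` — `HonestCore`(2) (`drain_disc`) and (3) (`tube_closure`);
* `seamed₂_six`, `seamed₂_ten` — `Seamed` S6 (ONE ATLAS, from A3) and S10 (far leaves in the
  radiation zone, from the collar bookkeeping);
* `stub_seamSurgery_timeShift` (registered helper sub-goal, anchor).

Mathlib + the landed seam helper modules; no definitions, no named facts.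
-/

noncomputable section

open scoped Manifold ContDiff Topology ENNReal
open Filter Set Function Topology Literature.Geometry.Lorentzian

namespace Summit.FinalStateConjecture.FinalStateConjecture.Theorems.NecksCertifyTwoCap.Seam

set_option linter.dupNamespace false

/-- Registered helper sub-goal `stub_seamSurgery_timeShift` of N2 (anchor of this file): the
re-clocked late region `{t − s > T}` is the late region `{t > T + s}`. [folklore] -/
theorem stub_seamSurgery_timeShift :
    ∀ (t : E4 → ℝ) (s T : ℝ) (y : E4), T < t y - s ↔ T + s < t y :=
  fun _ _ _ _ ↦ ⟨fun h ↦ by linarith, fun h ↦ by linarith⟩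

variable {𝓢 : Spacetime.{0} 4}

/-- Structure field `isLateChart` of the seamed decomposition for one hole: the new chart
`Gl ∘ inclusion` on the re-clocked background is a late-time chart after `T` (smooth; open embedding of
`{t₂ > T} = {t > T + s}`; image in `O`). [folklore] -/
theorem isLateChart₂ (Λ : lorentzGroup) (c : E4) (M a τ₁ s T : ℝ) (hT : τ₁ + 3 ≤ T)
    (Gl : (boostedKerrBackground Λ c M a).domain → 𝓢.carrier)
    (hGl1 : ContMDiff 𝓘(ℝ, E4) (𝓡 4) ∞ Gl)
    (hGl4 : ∀ Tl : ℝ, τ₁ + 2 + s ≤ Tl → IsOpenEmbedding (Set.restrict {x : (boostedKerrBackground Λ c M a).domain | Tl < (boostedKerrBackground Λ c M a).time x} Gl))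
    (O : Set 𝓢.carrier)
    (hGl5 : ∀ x, Gl x ∈ O)
    (B₂ : ModelBackground) (hle : B₂.domain ≤ (boostedKerrBackground Λ c M a).domain) (htime : ∀ y, B₂.time y = (boostedKerrBackground Λ c M a).time y - s) :
    𝓢.IsLateChart B₂ O T (Gl ∘ TopologicalSpace.Opens.inclusion hle) := by
  have hTc : Continuous (boostedKerrBackground Λ c M a).time := (PiLp.continuous_apply 2 _ 0).comp (continuous_poincareInv Λ c)
  refine ⟨hGl1.comp (contMDiff_inclusion _), ?_, ?_⟩
  · refine isOpenEmbedding_restrict_comp_inclusion hle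
      (isOpen_lt continuous_const (hTc.comp continuous_subtype_val))
      (isOpen_lt continuous_const ?_) (fun x hx ↦ ?_) (hGl4 (T + s) (by linarith))
    · exact ((hTc.sub continuous_const).comp continuous_subtype_val).congr fun x ↦ (htime x.1).symm
    · have hx' : T < B₂.time x.1 := hx
      rw [htime] at hx'
      show T + s < (boostedKerrBackground Λ c M a).time x.1
      linarith
  · rintro _ ⟨x, -, rfl⟩
    exact hGl5 _

/-- `HonestCore`(2) of the seamed decomposition for one hole, in the re-clocked vocabulary
(`drain_disc` of `…StubSeamSurgeryDisc`). O'Neill 1983, Ch. 14, p. 402. [folklore] -/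
theorem honestCore₂_two (Λ : lorentzGroup) (c : E4) (M a R₁ τ₁ s τf T : ℝ)
    (hR₁4 : 0 < R₁ + 4)
    (hs : 0 ≤ s)
    (hτ : τf ≤ τ₁)
    (hT : τ₁ + 3 ≤ T)
    (hdomR : ∀ y : E4, R₁ + 4 < (boostedKerrBackground Λ c M a).radius y → y ∈ (boostedKerrBackground Λ c M a).domain)
    (hdompos : ∀ y : E4, y ∈ (boostedKerrBackground Λ c M a).domain → 0 < (boostedKerrBackground Λ c M a).radius y)
    (hdomeq : ∀ y y' : E4, (boostedKerrBackground Λ c M a).radius y' = (boostedKerrBackground Λ c M a).radius y → y ∈ (boostedKerrBackground Λ c M a).domain → y' ∈ (boostedKerrBackground Λ c M a).domain)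
    (Rg : ℝ → ℝ)
    (hRgm : Monotone Rg)
    (hRgc : Continuous Rg)
    (hRg4 : ∀ t, R₁ + 4 ≤ Rg t)
    (b : ℝ → ℝ)
    (hbm : Monotone b)
    (hbRg : ∀ t, Rg t + 21 / 20 ≤ b t ∧ b t ≤ Rg t + 29 / 20)
    (σ : ℝ → ℝ → ℝ) (G : E4 → E4)
    (hσ2 : ∀ t, StrictMono (σ t))
    (hσ3 : ∀ t ρ, σ t ρ < b t + 1 / 2)
    (hσ4 : ∀ t ρ, b t ≤ ρ → b t ≤ σ t ρ)
    (hσ5 : ∀ t t' ρ, t ≤ t' → σ t ρ ≤ σ t' ρ)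
    (hσ8 : ∀ t ρ, b t ≤ ρ → σ t ρ ≤ ρ)
    (hG1 : ∀ y, (boostedKerrBackground Λ c M a).time (G y) = (boostedKerrBackground Λ c M a).time y)
    (hG2 : ∀ y, 0 < (boostedKerrBackground Λ c M a).radius y → (boostedKerrBackground Λ c M a).radius (G y) = σ ((boostedKerrBackground Λ c M a).time y) ((boostedKerrBackground Λ c M a).radius y))
    (hG3 : ∀ y, 0 < (boostedKerrBackground Λ c M a).radius y → (boostedKerrBackground Λ c M a).radius y ≤ b ((boostedKerrBackground Λ c M a).time y) → G y = y)
    (hG7 : ∀ z, R₁ + 4 < (boostedKerrBackground Λ c M a).radius z → (∃ ϱ, (boostedKerrBackground Λ c M a).radius z < σ ((boostedKerrBackground Λ c M a).time z) ϱ) →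
      ∃ y, R₁ + 4 < (boostedKerrBackground Λ c M a).radius y ∧ (boostedKerrBackground Λ c M a).time y = (boostedKerrBackground Λ c M a).time z ∧ G y = z)
    (Ψ Ψ' Gl : (boostedKerrBackground Λ c M a).domain → 𝓢.carrier)
    (hA1a : ContMDiffOn 𝓘(ℝ, E4) (𝓡 4) ∞ Ψ'
      {x | τ₁ < (boostedKerrBackground Λ c M a).time x ∧ (boostedKerrBackground Λ c M a).radius x < Rg ((boostedKerrBackground Λ c M a).time x) + 2})
    (hA2 : ∀ x : (boostedKerrBackground Λ c M a).domain, (boostedKerrBackground Λ c M a).radius x ≤ R₁ + 1 → Ψ' x = Ψ x)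
    (hA8 : ∀ x : (boostedKerrBackground Λ c M a).domain, τ₁ ≤ (boostedKerrBackground Λ c M a).time x → R₁ ≤ (boostedKerrBackground Λ c M a).radius x →
      (boostedKerrBackground Λ c M a).radius x ≤ Rg ((boostedKerrBackground Λ c M a).time x) + 2 →
      𝓢.timeOrientation.IsFutureDirected (mfderiv 𝓘(ℝ, E4) (𝓡 4) Ψ' x ((Λ : E4 ≃L[ℝ] E4) (E4.basisVector 0))))
    (hHc2 : ∀ ϱ τ₂ : ℝ, R₁ ≤ ϱ → τf < τ₂ →
      Ψ '' {x | τf < (boostedKerrBackground Λ c M a).time x ∧ (boostedKerrBackground Λ c M a).time x < τ₂ ∧ (boostedKerrBackground Λ c M a).radius x < ϱ} ⊆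
        𝓢.metric.causalPast 𝓢.timeOrientation (Ψ '' (boostedKerrBackground Λ c M a).truncTimeSlab ϱ τ₂))
    (W₀ : TopologicalSpace.Opens E4) (Φ : W₀ → 𝓢.carrier) (P : E4 → Prop)
    (hA3 : ∀ (y : E4) (hy : y ∈ (boostedKerrBackground Λ c M a).domain), τ₁ ≤ y 0 → P y →
      (boostedKerrBackground Λ c M a).radius y ≤ Rg ((boostedKerrBackground Λ c M a).time y) + 2 → ∃ hw : y ∈ W₀, Ψ' ⟨y, hy⟩ = Φ ⟨y, hw⟩)
    (hcollar : ∀ y : E4, y ∈ (boostedKerrBackground Λ c M a).domain → τ₁ + 1 + s < (boostedKerrBackground Λ c M a).time y →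
      Rg ((boostedKerrBackground Λ c M a).time y) + 17 / 20 < (boostedKerrBackground Λ c M a).radius y → (boostedKerrBackground Λ c M a).radius y < Rg ((boostedKerrBackground Λ c M a).time y) + 2 →
      τ₁ ≤ y 0 ∧ τf < y 0 ∧ P y)
    (hGl2 : ∀ x : (boostedKerrBackground Λ c M a).domain, τ₁ + 2 + s ≤ (boostedKerrBackground Λ c M a).time x → (boostedKerrBackground Λ c M a).radius x < b ((boostedKerrBackground Λ c M a).time x) → Gl x = Ψ' x)
    (hGl3 : ∀ x : (boostedKerrBackground Λ c M a).domain, τ₁ + 2 + s ≤ (boostedKerrBackground Λ c M a).time x → b ((boostedKerrBackground Λ c M a).time x) ≤ (boostedKerrBackground Λ c M a).radius x →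
      ∃ hw : G x ∈ W₀, Gl x = Φ ⟨G x, hw⟩ ∧ τf < G x 0)
    (B₂ : ModelBackground) (hle : B₂.domain ≤ (boostedKerrBackground Λ c M a).domain) (hset : ((boostedKerrBackground Λ c M a).domain : Set E4) ⊆ B₂.domain)
    (htime : ∀ y, B₂.time y = (boostedKerrBackground Λ c M a).time y - s) (hrad : ∀ y, B₂.radius y = (boostedKerrBackground Λ c M a).radius y) :
    ∀ (ϱ τ₂ : ℝ), R₁ ≤ ϱ → T < τ₂ →
      (Gl ∘ TopologicalSpace.Opens.inclusion hle) '' {x | T < B₂.time x ∧ B₂.time x < τ₂ ∧ B₂.radius x < ϱ} ⊆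
      𝓢.metric.causalPast 𝓢.timeOrientation ((Gl ∘ TopologicalSpace.Opens.inclusion hle) '' B₂.truncTimeSlab ϱ τ₂) := by
  intro ϱ τ₂ hϱ hτ₂
  rintro _ ⟨x, ⟨hx1, hx2, hx3⟩, rfl⟩
  have hx1' : T < B₂.time x.1 := hx1
  have hx2' : B₂.time x.1 < τ₂ := hx2
  have hx3' : B₂.radius x.1 < ϱ := hx3
  rw [htime] at hx1' hx2'
  rw [hrad] at hx3'
  have key := drain_disc Λ c M a R₁ τ₁ s τf T hR₁4 hs hτ hT hdomR hdompos hdomeq Rg hRgm hRgc hRg4 b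
    hbm hbRg σ G hσ2 hσ3 hσ4 hσ5 hσ8 hG1 hG2 hG3 hG7 Ψ Ψ' Gl hA1a hA2 hA8 hHc2 W₀ Φ P hA3 hcollar
    hGl2 hGl3 x.1 (hle x.2) τ₂ ϱ (by linarith) (by linarith) hx3' hϱ
  refine LorentzianMetric.causalFuture_mono ?_ key
  rintro _ ⟨y, ⟨hyt, hyr⟩, rfl⟩
  have hyt' : (boostedKerrBackground Λ c M a).time y = τ₂ + s := hyt
  have hyr' : (boostedKerrBackground Λ c M a).radius y ≤ ϱ := hyr
  refine ⟨⟨y.1, hset y.2⟩, ⟨by show B₂.time y.1 = τ₂; rw [htime]; linarith,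
    by show B₂.radius y.1 ≤ ϱ; rw [hrad]; exact hyr'⟩, rfl⟩

/-- `HonestCore`(3) of the seamed decomposition for one hole, in the re-clocked vocabulary
(`tube_closure` of `…StubSeamSurgeryClosure`). DHRT arXiv:2104.08222, §1. [folklore] -/
theorem honestCore₂_three (Λ : lorentzGroup) (c : E4) (M a R₁ τ₁ s τf T : ℝ)
    (hs : 0 ≤ s)
    (hτ : τf ≤ τ₁)
    (hT : τ₁ + 3 ≤ T)
    (hdomR : ∀ y : E4, R₁ + 4 < (boostedKerrBackground Λ c M a).radius y → y ∈ (boostedKerrBackground Λ c M a).domain)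
    (hdompos : ∀ y : E4, y ∈ (boostedKerrBackground Λ c M a).domain → 0 < (boostedKerrBackground Λ c M a).radius y)
    (Rg : ℝ → ℝ)
    (hRg4 : ∀ t, R₁ + 4 ≤ Rg t)
    (b : ℝ → ℝ)
    (hbc : Continuous b)
    (hbRg : ∀ t, Rg t + 21 / 20 ≤ b t ∧ b t ≤ Rg t + 29 / 20)
    (σ : ℝ → ℝ → ℝ) (G : E4 → E4)
    (hσ1 : ∀ t ρ, ρ ≤ b t → σ t ρ = ρ)
    (hσ2 : ∀ t, StrictMono (σ t))
    (hσ3 : ∀ t ρ, σ t ρ < b t + 1 / 2)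
    (hσ4 : ∀ t ρ, b t ≤ ρ → b t ≤ σ t ρ)
    (hσ6 : Continuous (fun p : ℝ × ℝ ↦ σ p.1 p.2))
    (hG1 : ∀ y, (boostedKerrBackground Λ c M a).time (G y) = (boostedKerrBackground Λ c M a).time y)
    (hG2 : ∀ y, 0 < (boostedKerrBackground Λ c M a).radius y → (boostedKerrBackground Λ c M a).radius (G y) = σ ((boostedKerrBackground Λ c M a).time y) ((boostedKerrBackground Λ c M a).radius y))
    (hG3 : ∀ y, 0 < (boostedKerrBackground Λ c M a).radius y → (boostedKerrBackground Λ c M a).radius y ≤ b ((boostedKerrBackground Λ c M a).time y) → G y = y)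
    (hG7 : ∀ z, R₁ + 4 < (boostedKerrBackground Λ c M a).radius z → (∃ ϱ, (boostedKerrBackground Λ c M a).radius z < σ ((boostedKerrBackground Λ c M a).time z) ϱ) →
      ∃ y, R₁ + 4 < (boostedKerrBackground Λ c M a).radius y ∧ (boostedKerrBackground Λ c M a).time y = (boostedKerrBackground Λ c M a).time z ∧ G y = z)
    (Ψ' Gl : (boostedKerrBackground Λ c M a).domain → 𝓢.carrier)
    (O : Set 𝓢.carrier)
    (hA12 : ∀ (τ'' : ℝ) (ϱ' : ℝ → ℝ), Continuous ϱ' → τ₁ < τ'' → (∀ t, ϱ' t < Rg t + 2) →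
      closure (Ψ' '' {x | τ'' ≤ (boostedKerrBackground Λ c M a).time x ∧ (boostedKerrBackground Λ c M a).radius x ≤ ϱ' ((boostedKerrBackground Λ c M a).time x)}) ∩ O ⊆
        Ψ' '' {x | τ'' ≤ (boostedKerrBackground Λ c M a).time x ∧ (boostedKerrBackground Λ c M a).radius x ≤ ϱ' ((boostedKerrBackground Λ c M a).time x)})
    (W₀ : TopologicalSpace.Opens E4) (Φ : W₀ → 𝓢.carrier) (P : E4 → Prop)
    (Q : E4 → Prop)
    (hΦ2 : IsOpenEmbedding (Set.restrict {w : W₀ | τf < w.1 0} Φ))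
    (hf2 : ∀ τ'' : ℝ, τf < τ'' →
      closure (Φ '' {y : W₀ | τ'' ≤ y.1 0 ∧ Q y.1}) ⊆ Φ '' {y : W₀ | τ'' ≤ y.1 0})
    (hPQ : ∀ y : E4, τ₁ ≤ y 0 → P y → Q y)
    (hA3 : ∀ (y : E4) (hy : y ∈ (boostedKerrBackground Λ c M a).domain), τ₁ ≤ y 0 → P y →
      (boostedKerrBackground Λ c M a).radius y ≤ Rg ((boostedKerrBackground Λ c M a).time y) + 2 → ∃ hw : y ∈ W₀, Ψ' ⟨y, hy⟩ = Φ ⟨y, hw⟩)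
    (hcollar : ∀ y : E4, y ∈ (boostedKerrBackground Λ c M a).domain → τ₁ + 1 + s < (boostedKerrBackground Λ c M a).time y →
      Rg ((boostedKerrBackground Λ c M a).time y) + 17 / 20 < (boostedKerrBackground Λ c M a).radius y → (boostedKerrBackground Λ c M a).radius y < Rg ((boostedKerrBackground Λ c M a).time y) + 2 →
      τ₁ ≤ y 0 ∧ τf < y 0 ∧ P y)
    (hlag : ∀ y : E4, τ₁ ≤ (boostedKerrBackground Λ c M a).time y → (boostedKerrBackground Λ c M a).radius y ≤ Rg ((boostedKerrBackground Λ c M a).time y) + 2 → (boostedKerrBackground Λ c M a).time y - s ≤ y 0)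
    (hGl2 : ∀ x : (boostedKerrBackground Λ c M a).domain, τ₁ + 2 + s ≤ (boostedKerrBackground Λ c M a).time x → (boostedKerrBackground Λ c M a).radius x < b ((boostedKerrBackground Λ c M a).time x) → Gl x = Ψ' x)
    (hGl3 : ∀ x : (boostedKerrBackground Λ c M a).domain, τ₁ + 2 + s ≤ (boostedKerrBackground Λ c M a).time x → b ((boostedKerrBackground Λ c M a).time x) ≤ (boostedKerrBackground Λ c M a).radius x →
      ∃ hw : G x ∈ W₀, Gl x = Φ ⟨G x, hw⟩ ∧ τf < G x 0)
    (B₂ : ModelBackground) (hle : B₂.domain ≤ (boostedKerrBackground Λ c M a).domain) (hset : ((boostedKerrBackground Λ c M a).domain : Set E4) ⊆ B₂.domain)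
    (htime : ∀ y, B₂.time y = (boostedKerrBackground Λ c M a).time y - s) (hrad : ∀ y, B₂.radius y = (boostedKerrBackground Λ c M a).radius y) :
    ∀ (τ' : ℝ) (ϱ : ℝ → ℝ), Continuous ϱ → T < τ' →
      closure ((Gl ∘ TopologicalSpace.Opens.inclusion hle) '' {x | τ' ≤ B₂.time x ∧ B₂.radius x ≤ ϱ (B₂.time x)}) ∩ O ⊆
        (Gl ∘ TopologicalSpace.Opens.inclusion hle) '' {x | τ' ≤ B₂.time x ∧ B₂.radius x ≤ ϱ (B₂.time x)} := by
  intro τ' ϱ hϱ hτ'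
  have key := tube_closure Λ c M a R₁ τ₁ s τf T hs hτ hT hdomR hdompos Rg hRg4 b hbc hbRg σ G hσ1 hσ2
    hσ3 hσ4 hσ6 hG1 hG2 hG3 hG7 Ψ' Gl O hA12 W₀ Φ P Q hΦ2 hf2 hPQ hA3 hcollar hlag hGl2 hGl3 τ' ϱ hϱ hτ'
  have himg : (Gl ∘ TopologicalSpace.Opens.inclusion hle) '' {x | τ' ≤ B₂.time x ∧ B₂.radius x ≤ ϱ (B₂.time x)} =
      Gl '' {x | τ' + s ≤ (boostedKerrBackground Λ c M a).time x ∧ (boostedKerrBackground Λ c M a).radius x ≤ ϱ ((boostedKerrBackground Λ c M a).time x - s)} := by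
    apply Subset.antisymm
    · rintro _ ⟨x, ⟨h1, h2⟩, rfl⟩
      have h1' : τ' ≤ B₂.time x.1 := h1
      have h2' : B₂.radius x.1 ≤ ϱ (B₂.time x.1) := h2
      rw [htime] at h1' h2'; rw [hrad] at h2'
      exact ⟨TopologicalSpace.Opens.inclusion hle x, ⟨by show τ' + s ≤ (boostedKerrBackground Λ c M a).time x.1; linarith, h2'⟩, rfl⟩
    · rintro _ ⟨x, ⟨h1, h2⟩, rfl⟩
      refine ⟨⟨x.1, hset x.2⟩, ⟨by show τ' ≤ B₂.time x.1; rw [htime]; linarith,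
        by show B₂.radius x.1 ≤ ϱ (B₂.time x.1); rw [htime, hrad]; exact h2⟩, rfl⟩
  rw [himg]
  exact key

/-- `Seamed` S6 (ONE ATLAS) of the seamed decomposition for one hole, in the re-clocked vocabulary:
a flat-late point outside the tubes with `r ≤ Rg(t) + 1` is inside the shell, where the new chart
is `Ψ' = Φ` (A3); `P'` is the tube condition of the new decomposition, implying the old one `P`.
[folklore] -/
theorem seamed₂_six (Λ : lorentzGroup) (c : E4) (M a τ₁ s T : ℝ) (hT : τ₁ + 3 ≤ T)
    (Rg : ℝ → ℝ)
    (b : ℝ → ℝ)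
    (hbRg : ∀ t, Rg t + 21 / 20 ≤ b t)
    (Ψ' Gl : (boostedKerrBackground Λ c M a).domain → 𝓢.carrier)
    (W₀ : TopologicalSpace.Opens E4) (Φ : W₀ → 𝓢.carrier) (P P' : E4 → Prop) (hPP' : ∀ y, P' y → P y)
    (hA3 : ∀ (y : E4) (hy : y ∈ (boostedKerrBackground Λ c M a).domain), τ₁ ≤ y 0 → P y →
      (boostedKerrBackground Λ c M a).radius y ≤ Rg ((boostedKerrBackground Λ c M a).time y) + 2 → ∃ hw : y ∈ W₀, Ψ' ⟨y, hy⟩ = Φ ⟨y, hw⟩)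
    (hYle : ∀ y : E4, T ≤ y 0 → (boostedKerrBackground Λ c M a).radius y ≤ Rg ((boostedKerrBackground Λ c M a).time y) + 2 → τ₁ + 3 ≤ (boostedKerrBackground Λ c M a).time y - s)
    (hGl2 : ∀ x : (boostedKerrBackground Λ c M a).domain, τ₁ + 2 + s ≤ (boostedKerrBackground Λ c M a).time x → (boostedKerrBackground Λ c M a).radius x < b ((boostedKerrBackground Λ c M a).time x) → Gl x = Ψ' x)
    (B₂ : ModelBackground) (hle : B₂.domain ≤ (boostedKerrBackground Λ c M a).domain)
    (htime : ∀ y, B₂.time y = (boostedKerrBackground Λ c M a).time y - s) (hrad : ∀ y, B₂.radius y = (boostedKerrBackground Λ c M a).radius y)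
    (U₂ : TopologicalSpace.Opens E4) (hU₂le : U₂ ≤ W₀) (hUmk : ∀ y : E4, T - 1 < y 0 → P y → y ∈ U₂) :
    ∀ (y : E4) (hy : y ∈ B₂.domain), T ≤ y 0 → P' y → B₂.radius y ≤ Rg (B₂.time y + s) + 1 →
      ∃ hy' : y ∈ U₂, (Gl ∘ TopologicalSpace.Opens.inclusion hle) ⟨y, hy⟩ = (Φ ∘ TopologicalSpace.Opens.inclusion hU₂le) ⟨y, hy'⟩ := by
  intro y hy hy0 hP hr
  have hP' : P y := hPP' y hP
  rw [hrad, htime, sub_add_cancel] at hr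
  have hYy := hYle y hy0 (by linarith)
  have hyU : y ∈ U₂ := hUmk y (by linarith) hP'
  refine ⟨hyU, ?_⟩
  have hyd : y ∈ (boostedKerrBackground Λ c M a).domain := hle hy
  obtain ⟨hw, heq⟩ := hA3 y hyd (by linarith) hP' (by linarith)
  show Gl ⟨y, hyd⟩ = Φ ⟨y, hU₂le hyU⟩
  rw [hGl2 ⟨y, hyd⟩ (by show _ ≤ (boostedKerrBackground Λ c M a).time y; linarith)
    (by show (boostedKerrBackground Λ c M a).radius y < b ((boostedKerrBackground Λ c M a).time y); linarith [hbRg ((boostedKerrBackground Λ c M a).time y)]), heq]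

/-- `Seamed` S10 of the seamed decomposition for one hole, in the re-clocked vocabulary: the new
chart's image of `{t₂ > T, r > Rg(t) + 1}` lies in the flat chart's late image outside the tubes
(inside the shell `Gl = Ψ' = Φ` on the collar by A3; outside, `Gl = Φ ∘ G` with `G x` a flat-late
collar point). [folklore] -/
theorem seamed₂_ten (Λ : lorentzGroup) (c : E4) (M a R₁ τ₁ s τf T : ℝ)
    (hs : 0 ≤ s)
    (hT : τ₁ + 3 ≤ T)
    (hdomR : ∀ y : E4, R₁ + 4 < (boostedKerrBackground Λ c M a).radius y → y ∈ (boostedKerrBackground Λ c M a).domain)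
    (hdompos : ∀ y : E4, y ∈ (boostedKerrBackground Λ c M a).domain → 0 < (boostedKerrBackground Λ c M a).radius y)
    (Rg : ℝ → ℝ)
    (hRg4 : ∀ t, R₁ + 4 ≤ Rg t)
    (b : ℝ → ℝ)
    (hbRg : ∀ t, Rg t + 21 / 20 ≤ b t ∧ b t ≤ Rg t + 29 / 20)
    (σ : ℝ → ℝ → ℝ) (G : E4 → E4)
    (hσ3 : ∀ t ρ, σ t ρ < b t + 1 / 2)
    (hσ4 : ∀ t ρ, b t ≤ ρ → b t ≤ σ t ρ)
    (hG1 : ∀ y, (boostedKerrBackground Λ c M a).time (G y) = (boostedKerrBackground Λ c M a).time y)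
    (hG2 : ∀ y, 0 < (boostedKerrBackground Λ c M a).radius y → (boostedKerrBackground Λ c M a).radius (G y) = σ ((boostedKerrBackground Λ c M a).time y) ((boostedKerrBackground Λ c M a).radius y))
    (Ψ' Gl : (boostedKerrBackground Λ c M a).domain → 𝓢.carrier)
    (W₀ : TopologicalSpace.Opens E4) (Φ : W₀ → 𝓢.carrier) (P : E4 → Prop)
    (hA3 : ∀ (y : E4) (hy : y ∈ (boostedKerrBackground Λ c M a).domain), τ₁ ≤ y 0 → P y →
      (boostedKerrBackground Λ c M a).radius y ≤ Rg ((boostedKerrBackground Λ c M a).time y) + 2 → ∃ hw : y ∈ W₀, Ψ' ⟨y, hy⟩ = Φ ⟨y, hw⟩)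
    (hcollar : ∀ y : E4, y ∈ (boostedKerrBackground Λ c M a).domain → τ₁ + 1 + s < (boostedKerrBackground Λ c M a).time y →
      Rg ((boostedKerrBackground Λ c M a).time y) + 17 / 20 < (boostedKerrBackground Λ c M a).radius y → (boostedKerrBackground Λ c M a).radius y < Rg ((boostedKerrBackground Λ c M a).time y) + 2 →
      τ₁ ≤ y 0 ∧ τf < y 0 ∧ P y)
    (hlag : ∀ y : E4, τ₁ ≤ (boostedKerrBackground Λ c M a).time y → (boostedKerrBackground Λ c M a).radius y ≤ Rg ((boostedKerrBackground Λ c M a).time y) + 2 → (boostedKerrBackground Λ c M a).time y - s ≤ y 0)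
    (hGl2 : ∀ x : (boostedKerrBackground Λ c M a).domain, τ₁ + 2 + s ≤ (boostedKerrBackground Λ c M a).time x → (boostedKerrBackground Λ c M a).radius x < b ((boostedKerrBackground Λ c M a).time x) → Gl x = Ψ' x)
    (hGl3 : ∀ x : (boostedKerrBackground Λ c M a).domain, τ₁ + 2 + s ≤ (boostedKerrBackground Λ c M a).time x → b ((boostedKerrBackground Λ c M a).time x) ≤ (boostedKerrBackground Λ c M a).radius x →
      ∃ hw : G x ∈ W₀, Gl x = Φ ⟨G x, hw⟩ ∧ τf < G x 0)
    (B₂ : ModelBackground) (hle : B₂.domain ≤ (boostedKerrBackground Λ c M a).domain)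
    (htime : ∀ y, B₂.time y = (boostedKerrBackground Λ c M a).time y - s) (hrad : ∀ y, B₂.radius y = (boostedKerrBackground Λ c M a).radius y)
    (U₂ : TopologicalSpace.Opens E4) (hU₂le : U₂ ≤ W₀) (hUmk : ∀ y : E4, T - 1 < y 0 → P y → y ∈ U₂) :
    (Gl ∘ TopologicalSpace.Opens.inclusion hle) '' {x | T < B₂.time x ∧ Rg (B₂.time x + s) + 1 < B₂.radius x} ⊆
      (Φ ∘ TopologicalSpace.Opens.inclusion hU₂le) '' (Minkowski.backgroundOn U₂).lateRegion T := by
  rintro _ ⟨x, ⟨hxt, hxr⟩, rfl⟩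
  have ht : T < (boostedKerrBackground Λ c M a).time x.1 - s := by have h := hxt; rwa [htime] at h
  have hr : Rg ((boostedKerrBackground Λ c M a).time x.1) + 1 < (boostedKerrBackground Λ c M a).radius x.1 := by
    have h := hxr; rwa [htime, hrad, sub_add_cancel] at h
  have hxd : (x : E4) ∈ (boostedKerrBackground Λ c M a).domain := hle x.2
  have hb1 := (hbRg ((boostedKerrBackground Λ c M a).time x.1)).1
  have hb2 := (hbRg ((boostedKerrBackground Λ c M a).time x.1)).2
  rcases lt_or_ge ((boostedKerrBackground Λ c M a).radius x.1) (b ((boostedKerrBackground Λ c M a).time x.1)) with h1 | h1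
  · obtain ⟨hx0, -, hPx⟩ := hcollar x.1 hxd (by linarith) (by linarith) (by linarith)
    obtain ⟨hw, heq⟩ := hA3 x.1 hxd hx0 hPx (by linarith)
    have hlg := hlag x.1 (by linarith) (by linarith)
    have hxU : (x : E4) ∈ U₂ := hUmk x.1 (by linarith) hPx
    refine ⟨⟨x.1, hxU⟩, by show T < x.1 0; linarith, ?_⟩
    show Φ ⟨x.1, hU₂le hxU⟩ = Gl ⟨x.1, hxd⟩
    rw [hGl2 ⟨x.1, hxd⟩ (by show _ ≤ (boostedKerrBackground Λ c M a).time x.1; linarith) h1, heq]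
  · obtain ⟨hw, hGl, -⟩ := hGl3 ⟨x.1, hxd⟩ (by show _ ≤ (boostedKerrBackground Λ c M a).time x.1; linarith) h1
    have hr0 : 0 < (boostedKerrBackground Λ c M a).radius x.1 := hdompos x.1 hxd
    have htz : (boostedKerrBackground Λ c M a).time (G x.1) = (boostedKerrBackground Λ c M a).time x.1 := hG1 x.1
    have hrz : (boostedKerrBackground Λ c M a).radius (G x.1) = σ ((boostedKerrBackground Λ c M a).time x.1) ((boostedKerrBackground Λ c M a).radius x.1) := hG2 x.1 hr0
    have hrz1 : b ((boostedKerrBackground Λ c M a).time x.1) ≤ (boostedKerrBackground Λ c M a).radius (G x.1) := by rw [hrz]; exact hσ4 _ _ h1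
    have hrz2 : (boostedKerrBackground Λ c M a).radius (G x.1) < b ((boostedKerrBackground Λ c M a).time x.1) + 1 / 2 := by rw [hrz]; exact hσ3 _ _
    have hzd : G x.1 ∈ (boostedKerrBackground Λ c M a).domain := hdomR _ (by linarith [hRg4 ((boostedKerrBackground Λ c M a).time x.1)])
    obtain ⟨-, -, hPz⟩ := hcollar (G x.1) hzd (by rw [htz]; linarith) (by rw [htz]; linarith)
      (by rw [htz]; linarith)
    have hlg := hlag (G x.1) (by rw [htz]; linarith) (by rw [htz]; linarith)
    rw [htz] at hlg
    have hzU : G x.1 ∈ U₂ := hUmk _ (by linarith) hPz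
    refine ⟨⟨G x.1, hzU⟩, by show T < (G x.1) 0; linarith, ?_⟩
    show Φ ⟨G x.1, hU₂le hzU⟩ = Gl ⟨x.1, hxd⟩
    rw [hGl]

end Summit.FinalStateConjecture.FinalStateConjecture.Theorems.NecksCertifyTwoCap.Seam

end
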